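import Literature.NumberTheory.Rogawski1990.ArchEndoscopicTransferCompatibleOfDiagonal   -- ★ parent (N9-DIAG §1–§3): `ArchCompatibleFamiliesG.transport_archCongr`, `…_of_archCongr`, their closure
import Literature.NumberTheory.Rogawski1990.ArchCompatibleFamiliesGDet                    -- ★ (R-a) the `det ≠ 0` twin `ArchCompatibleFamiliesGDet` of the system predicate
import HarnessLib

/-!
# The archimedean endoscopic transfer of `C_c^∞` along a congruence of the inner form, keyed on `det ≠ 0` instead of anisotropy
# (Rogawski 1990 §14.3 pp. 233–234, §14.4 p. 237, §4.3 (4.3.1) p. 43, §1.7 p. 6; Shelstad 1979 §4; Platonov–Rapinchuk §2.3)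

Topic `NumberTheory/Rogawski1990`; namespace `Literature.NumberTheory.Rogawski1990`.  THEOREMS ONLY over accepted tree modules (no definition, no instance, no notation,
no named fact, no `sorry`).  Cell `pub/hodgecm-mathlib`, programme R90-TF section S10 (Ch. 13.8), S10 dealer R90-C138-plan (g4) «J-ShelQS REFIT v2» item **(R-b2)** (DEAL #105;
census `K2/K2E4-p23/g4/CENSUS-DEAL99-ShelQS-N9refit.v2.md` 700eebdc §REVISED PLAN); seat LH4-p05 (g11).  Consumer: (R-c) `hShelQS_holds` (K2E5-p16 (g9)) — the archimedean
endoscopic transfer for the explicit factor `Δ″_∞` ON THE QUASI-SPLIT GROUP `U(Φ₃)(L ⊗ ℝ)` itself, where `Φ₃` is ISOTROPIC, so the ★ N9-DIAG transport (guarded by anisotropy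
`hanis`, which it reads only through ★ `Godement.det_ne_zero_of_anisotropic`) cannot be instantiated; this file is its `det ≠ 0` twin.

WHAT.  §1 **`ArchCompatibleFamiliesGDet.transport_archCongr`** — ★ `ArchCompatibleFamiliesG.transport_archCongr` VERBATIM with `hanis ↦ hdet` and ★ `ArchCompatibleFamiliesG ↦`
★ `ArchCompatibleFamiliesGDet`: a (W′)(W)(C′)(C)(C′G)-system is pushed along a frame `Φ : U(H₂)(L ⊗ ℝ) ≃ₜ* U(H)(L ⊗ ℝ)`, `Φ g = T g T⁻¹` (★ `isQuotientOf_transport_archCongr`,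
★ `map_archStableCentralizerEquiv_torusPush_eq(_of_cross)` — keyed on `det ≠ 0` already).  §2 **`isArchDeltaTransferExists_of_archCongr_of_det`** — the BODY of ★
`archEndoscopicTransferCompatible_of_archCongr` UNGUARDED: if on the target `U(H)` EVERY `det`-compatible system admits `Δ`-transfer of `C_c^∞` for the pushed factor
`T₂^Φ = T₂ ∘ (id × Φ⁻¹)` and the pushed Haar measure `Φ_* ν₂` («frame-relative transfer existence», ★ `IsArchDeltaTransferExists` on ★ `ArchSmooth`∕`ArchSmooth₂`), then every
`det`-compatible system on the source `U(H₂)` admits `T₂`-transfer: push the system (§1), transfer `a₂ ∘ Φ⁻¹` (★ `ArchSmooth.comp_archCongr_symm`), read (4.3.1) back (★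
`isArchDeltaTransfer_comap_iff`, ★ `TransferFactorData.comap_symm_comap`) — «`f′_v → f′_v^H` is defined via `f_v = f′_v ∘ ψ_v⁻¹`» (§14.4 p. 237).  §3
**`isArchDeltaTransferExists_explicit_formCongr_of_det`** — for the EXPLICIT factor `Δ″_∞` (★ `archExplicitTransferFactor`) along a RATIONAL congruence `P ∈ GL₃(L)`:
frame-relative transfer existence on `U(H′)(L ⊗ ℝ)` (for all Haar measures and both invariances of `Δ″^{H′}`) gives it on `U(ᵗc̄P H′ P)(L ⊗ ℝ)` (★ `archExplicitDelta_archCongr`: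
`Δ″` is a congruence invariant; the statement is CLOSED in the congruent form — its σ-algebra, Haar measure, `det` witness and invariances are bound inside — so a consumer
rewrites `ᵗc̄P H′ P` along a form identity such as ★ `formCongr_quasiSplitFrame_diagonal` (`ᵗQ̄ · diag(½,1,−½) · Q = Φ₃`) and lands on `U(Φ₃)` literally).
ZERO ★ edits: the guarded ★ theorems stay as they are; these are additive twins (the N8-INNER road's `…_of_ne_zero` pattern).

HONEST LABEL.  Count-neutral plumbing between congruent frames; proves no transfer by itself.  HC_CM is proved only modulo the 7 printed citations (2 remaining named inputs:
hLiu418 = stmt-HodgeConjecture-24832, h413 = stmt-HodgeConjecture-24833) until rung 0 closes.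

## References
* [Rogawski1990] J. D. Rogawski, *Automorphic Representations of Unitary Groups in Three Variables*, Ann. of Math. Stud. 123 (1990), §14.3 pp. 233–234 (the transfer
  `f′_∞ → f′^H_∞`), §14.4 p. 237 («`Δ″_v = Δ_v ∘ ψ_v`, `f_v = f′_v ∘ ψ_v⁻¹`»), §14.1 p. 232 (inner forms, congruent hermitian forms), §4.3 (4.3.1) p. 43, §1.7 p. 6 (compatible measures).
* [Shelstad1979] D. Shelstad, *Characters and inner forms of a quasi-split group over ℝ*, Compositio Math. 39 (1979), §4 p. 20 (transport of `dt` along the inner twist).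
* [PlatonovRapinchuk1994] V. Platonov, A. Rapinchuk, *Algebraic Groups and Number Theory* (1994), §2.3 (unitary groups of congruent forms are conjugate in `GL_N`).
-/

set_option autoImplicit false

noncomputable section

open MeasureTheory Measure NumberField NumberField.InfinitePlace NumberField.mixedEmbedding IsDedekindDomain
open Literature.MeasureTheory.Group

namespace Literature.NumberTheory.Rogawski1990

open Literature.NumberTheory.Automorphic Literature.NumberTheory.GaloisRepresentations
open Literature.AlgebraicGeometry.ShimuraVarieties (unitaryGroup hermForm)
open scoped Matrix ComplexOrder MatrixGroups

/-! ## §1–§2 Along an abstract congruence `Φ : U(H₂)(L ⊗ ℝ) ≃ₜ* U(H)(L ⊗ ℝ)`, `Φ g = T g T⁻¹`, keyed on `det ≠ 0` -/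

section Transport

variable (L : Type) [Field L] [NumberField L] [IsCMField L] {H H₂ : Matrix (Fin 3) (Fin 3) L} (T : GL (Fin 3) (mixedSpace L))
  (Φ : UnitaryGroup.arch (↥(maximalRealSubfield L)) L (IsCMField.complexConj L) 3 H₂ ≃ₜ* UnitaryGroup.arch (↥(maximalRealSubfield L)) L (IsCMField.complexConj L) 3 H)
  (hΦ : ∀ g : UnitaryGroup.arch (↥(maximalRealSubfield L)) L (IsCMField.complexConj L) 3 H₂, ((Φ g : UnitaryGroup.arch (↥(maximalRealSubfield L)) L (IsCMField.complexConj L) 3 H) : GL (Fin 3) (mixedSpace L)) = T * (g : GL (Fin 3) (mixedSpace L)) * T⁻¹)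
  [MeasurableSpace (UnitaryGroup.arch (↥(maximalRealSubfield L)) L (IsCMField.complexConj L) 3 H₂)] [BorelSpace (UnitaryGroup.arch (↥(maximalRealSubfield L)) L (IsCMField.complexConj L) 3 H₂)]
  [MeasurableSpace (UnitaryGroup.arch (↥(maximalRealSubfield L)) L (IsCMField.complexConj L) 3 H)] [BorelSpace (UnitaryGroup.arch (↥(maximalRealSubfield L)) L (IsCMField.complexConj L) 3 H)]
  [MeasurableSpace (UnitaryGroup.arch (↥(maximalRealSubfield L)) L (IsCMField.complexConj L) 3 (Matrix.of fun i j : Fin 3 => if i.val + j.val + 1 = 3 then (1 : L) else 0))] [BorelSpace (UnitaryGroup.arch (↥(maximalRealSubfield L)) L (IsCMField.complexConj L) 3 (Matrix.of fun i j : Fin 3 => if i.val + j.val + 1 = 3 then (1 : L) else 0))]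
  [MeasurableSpace (UnitaryGroup.arch (↥(maximalRealSubfield L)) L (IsCMField.complexConj L) 2 (Matrix.of fun i j : Fin 2 => if i.val + j.val + 1 = 2 then (1 : L) else 0) × UnitaryGroup.arch (↥(maximalRealSubfield L)) L (IsCMField.complexConj L) 1 (Matrix.of fun i j : Fin 1 => if i.val + j.val + 1 = 1 then (1 : L) else 0))] [BorelSpace (UnitaryGroup.arch (↥(maximalRealSubfield L)) L (IsCMField.complexConj L) 2 (Matrix.of fun i j : Fin 2 => if i.val + j.val + 1 = 2 then (1 : L) else 0) × UnitaryGroup.arch (↥(maximalRealSubfield L)) L (IsCMField.complexConj L) 1 (Matrix.of fun i j : Fin 1 => if i.val + j.val + 1 = 1 then (1 : L) else 0))]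
  (ν₂ : Measure (UnitaryGroup.arch (↥(maximalRealSubfield L)) L (IsCMField.complexConj L) 3 H₂)) [ν₂.IsHaarMeasure] [ν₂.IsMulRightInvariant]
  (νt : Measure (UnitaryGroup.arch (↥(maximalRealSubfield L)) L (IsCMField.complexConj L) 3 H)) [νt.IsHaarMeasure] [νt.IsMulRightInvariant] (hνt : νt = ν₂.map Φ)
  (ν : Measure (UnitaryGroup.arch (↥(maximalRealSubfield L)) L (IsCMField.complexConj L) 3 (Matrix.of fun i j : Fin 3 => if i.val + j.val + 1 = 3 then (1 : L) else 0))) [ν.IsHaarMeasure] [ν.IsMulRightInvariant]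
  (νH : Measure (UnitaryGroup.arch (↥(maximalRealSubfield L)) L (IsCMField.complexConj L) 2 (Matrix.of fun i j : Fin 2 => if i.val + j.val + 1 = 2 then (1 : L) else 0) × UnitaryGroup.arch (↥(maximalRealSubfield L)) L (IsCMField.complexConj L) 1 (Matrix.of fun i j : Fin 1 => if i.val + j.val + 1 = 1 then (1 : L) else 0))) [νH.IsHaarMeasure] [νH.IsMulRightInvariant]

omit [MeasurableSpace (UnitaryGroup.arch (↥(maximalRealSubfield L)) L (IsCMField.complexConj L) 2 (Matrix.of fun i j : Fin 2 => if i.val + j.val + 1 = 2 then (1 : L) else 0) × UnitaryGroup.arch (↥(maximalRealSubfield L)) L (IsCMField.complexConj L) 1 (Matrix.of fun i j : Fin 1 => if i.val + j.val + 1 = 1 then (1 : L) else 0))] [BorelSpace (UnitaryGroup.arch (↥(maximalRealSubfield L)) L (IsCMField.complexConj L) 2 (Matrix.of fun i j : Fin 2 => if i.val + j.val + 1 = 2 then (1 : L) else 0) × UnitaryGroup.arch (↥(maximalRealSubfield L)) L (IsCMField.complexConj L) 1 (Matrix.of fun i j : Fin 1 => if i.val + j.val + 1 = 1 then (1 : L)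 else 0))] in
include hΦ hνt in
/-- **§1 (det-keyed) `ArchCompatibleFamiliesGDet.transport_archCongr` — PRINT'S MEASURE CONVENTION IS CARRIED BY A CONGRUENCE OF THE INNER FORM, binder `det ≠ 0`.**
★ `ArchCompatibleFamiliesG.transport_archCongr` VERBATIM with the two anisotropy binders replaced by `hdetH : det H ≠ 0`, `hdet₂ : det H₂ ≠ 0` and the system predicate by its ★
`det`-twin `ArchCompatibleFamiliesGDet` ((R-a)): along the frame `Φ : U(H₂)(L ⊗ ℝ) ≃ₜ* U(H)(L ⊗ ℝ)`, `Φ g = T g T⁻¹`, a (W′)(W)(C′)(C)(C′G)-system `(m₂, m, t₂, t)` for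
`(U(H₂), U(Φ₃))` w.r.t. `(ν₂, ν)` is pushed to `(Φ_* m₂, m, t′, t)` for `(U(H), U(Φ₃))` w.r.t. `(Φ_* ν₂, ν)`, `t′` the torus push of ★ `exists_torusPush_archCongr`: (W′) ★
`isQuotientOf_transport_archCongr`, (C′) ★ `map_archStableCentralizerEquiv_torusPush_eq`, (C′G) ★ `map_archStableCentralizerEquiv_torusPush_eq_of_cross` — all three keyed on `det ≠ 0`
already — (W)(C) untouched.  The ★ parent reads `hanis` ONLY through ★ `Godement.det_ne_zero_of_anisotropic`; nothing else changes.  Print: «the pair `dt′, ψ_x` defines a measure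
`dt` on `T`, independently of the choice of `x`» (Shelstad), «compatible measures» (§1.7).
[cite: Rogawski1990, §1.7 p. 6; §4.3 (4.3.1) p. 43; §14.1 p. 232] [cite: Shelstad1979, §4 p. 20] [cite: PlatonovRapinchuk1994, §2.3] -/
theorem ArchCompatibleFamiliesGDet.transport_archCongr
    (hdetH : H.det ≠ 0) (hdet₂ : H₂.det ≠ 0)
    {m₂ : @OrbitalMeasureFamily (UnitaryGroup.arch (↥(maximalRealSubfield L)) L (IsCMField.complexConj L) 3 H₂) _ (fun _ => borel _)}
    {m : @OrbitalMeasureFamily (UnitaryGroup.arch (↥(maximalRealSubfield L)) L (IsCMField.complexConj L) 3 (Matrix.of fun i j : Fin 3 => if i.val + j.val + 1 = 3 then (1 : L) else 0)) _ (fun _ => borel _)}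
    {t₂ : ∀ γ : UnitaryGroup.arch (↥(maximalRealSubfield L)) L (IsCMField.complexConj L) 3 H₂,
      Measure (Subgroup.centralizer ({γ} : Set (UnitaryGroup.arch (↥(maximalRealSubfield L)) L (IsCMField.complexConj L) 3 H₂)))}
    {t : ∀ γ : UnitaryGroup.arch (↥(maximalRealSubfield L)) L (IsCMField.complexConj L) 3 (Matrix.of fun i j : Fin 3 => if i.val + j.val + 1 = 3 then (1 : L) else 0),
      Measure (Subgroup.centralizer ({γ} : Set (UnitaryGroup.arch (↥(maximalRealSubfield L)) L (IsCMField.complexConj L) 3 (Matrix.of fun i j : Fin 3 => if i.val + j.val + 1 = 3 then (1 : L) else 0))))}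
    (hG : ArchCompatibleFamiliesGDet L H₂ ν₂ ν hdet₂ m₂ m t₂ t) :
    letI : ∀ δ : UnitaryGroup.arch (↥(maximalRealSubfield L)) L (IsCMField.complexConj L) 3 H,
        MeasurableSpace (UnitaryGroup.arch (↥(maximalRealSubfield L)) L (IsCMField.complexConj L) 3 H ⧸ Subgroup.centralizer ({δ} : Set (UnitaryGroup.arch (↥(maximalRealSubfield L)) L (IsCMField.complexConj L) 3 H))) :=
      fun _ => borel _
    haveI : ∀ δ : UnitaryGroup.arch (↥(maximalRealSubfield L)) L (IsCMField.complexConj L) 3 H,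
        BorelSpace (UnitaryGroup.arch (↥(maximalRealSubfield L)) L (IsCMField.complexConj L) 3 H ⧸ Subgroup.centralizer ({δ} : Set (UnitaryGroup.arch (↥(maximalRealSubfield L)) L (IsCMField.complexConj L) 3 H))) :=
      fun _ => ⟨rfl⟩
    letI : ∀ γ : UnitaryGroup.arch (↥(maximalRealSubfield L)) L (IsCMField.complexConj L) 3 H₂,
        MeasurableSpace (UnitaryGroup.arch (↥(maximalRealSubfield L)) L (IsCMField.complexConj L) 3 H₂ ⧸ Subgroup.centralizer ({γ} : Set (UnitaryGroup.arch (↥(maximalRealSubfield L)) L (IsCMField.complexConj L) 3 H₂))) :=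
      fun _ => borel _
    haveI : ∀ γ : UnitaryGroup.arch (↥(maximalRealSubfield L)) L (IsCMField.complexConj L) 3 H₂,
        BorelSpace (UnitaryGroup.arch (↥(maximalRealSubfield L)) L (IsCMField.complexConj L) 3 H₂ ⧸ Subgroup.centralizer ({γ} : Set (UnitaryGroup.arch (↥(maximalRealSubfield L)) L (IsCMField.complexConj L) 3 H₂))) :=
      fun _ => ⟨rfl⟩
    ∃ tp : ∀ δ : UnitaryGroup.arch (↥(maximalRealSubfield L)) L (IsCMField.complexConj L) 3 H,
        Measure (Subgroup.centralizer ({δ} : Set (UnitaryGroup.arch (↥(maximalRealSubfield L)) L (IsCMField.complexConj L) 3 H))),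
      ArchCompatibleFamiliesGDet L H νt ν hdetH (m₂.transport Φ.toMulEquiv Φ.continuous Φ.symm.continuous) m tp t := by
  -- σ-algebras on the orbit quotients: Borel (the predicate's), named for the transport lemmas
  letI iTm : ∀ δ : UnitaryGroup.arch (↥(maximalRealSubfield L)) L (IsCMField.complexConj L) 3 H, MeasurableSpace (UnitaryGroup.arch (↥(maximalRealSubfield L)) L (IsCMField.complexConj L) 3 H ⧸ Subgroup.centralizer ({δ} : Set (UnitaryGroup.arch (↥(maximalRealSubfield L)) L (IsCMField.complexConj L) 3 H))) := fun _ => borel _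
  haveI iTb : ∀ δ : UnitaryGroup.arch (↥(maximalRealSubfield L)) L (IsCMField.complexConj L) 3 H, BorelSpace (UnitaryGroup.arch (↥(maximalRealSubfield L)) L (IsCMField.complexConj L) 3 H ⧸ Subgroup.centralizer ({δ} : Set (UnitaryGroup.arch (↥(maximalRealSubfield L)) L (IsCMField.complexConj L) 3 H))) := fun _ => ⟨rfl⟩
  letI iSm : ∀ γ : UnitaryGroup.arch (↥(maximalRealSubfield L)) L (IsCMField.complexConj L) 3 H₂, MeasurableSpace (UnitaryGroup.arch (↥(maximalRealSubfield L)) L (IsCMField.complexConj L) 3 H₂ ⧸ Subgroup.centralizer ({γ} : Set (UnitaryGroup.arch (↥(maximalRealSubfield L)) L (IsCMField.complexConj L) 3 H₂))) := fun _ => borel _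
  haveI iSb : ∀ γ : UnitaryGroup.arch (↥(maximalRealSubfield L)) L (IsCMField.complexConj L) 3 H₂, BorelSpace (UnitaryGroup.arch (↥(maximalRealSubfield L)) L (IsCMField.complexConj L) 3 H₂ ⧸ Subgroup.centralizer ({γ} : Set (UnitaryGroup.arch (↥(maximalRealSubfield L)) L (IsCMField.complexConj L) 3 H₂))) := fun _ => ⟨rfl⟩
  obtain ⟨hW₂, hW, hC₂, hC, hCG⟩ := hG
  -- the pushed torus datum (★ `ArchWeilDataCongruence` §1's lambda) and its defining equation
  obtain ⟨tp, htp⟩ := UnitaryGroup.exists_torusPush_archCongr L Φ t₂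
  refine ⟨tp, ?_, hW, ?_, hC, ?_⟩
  · -- (W′) the Weil form of `Φ_* m₂` w.r.t. the pushed torus datum
    exact UnitaryGroup.isQuotientOf_transport_archCongr L hdet₂ T Φ hΦ t₂ tp htp hW₂ hC₂ νt hνt
  · -- (C′) carried
    exact fun δ₁ δ₂ h₁ hc => UnitaryGroup.map_archStableCentralizerEquiv_torusPush_eq L hdetH
      hdet₂ T Φ hΦ t₂ tp htp hC₂ δ₁ δ₂ h₁ hc
  · -- (C′G) carried
    exact fun δ γ' h' hc => UnitaryGroup.map_archStableCentralizerEquiv_torusPush_eq_of_cross L hdetH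
      hdet₂ (UnitaryGroup.isUnit_antidiagOne_det L 3).ne_zero T Φ hΦ t₂ tp htp t hCG δ γ' h' hc

include hΦ hνt in
/-- **§2 (det-keyed, unguarded) FRAME-RELATIVE TRANSFER EXISTENCE IS CARRIED BY A CONGRUENCE OF THE INNER FORM.**  The BODY of ★ `archEndoscopicTransferCompatible_of_archCongr`
with the letter's guards `hherm`, `hanis` removed and the systems keyed on `det ≠ 0` (★ `ArchCompatibleFamiliesGDet`): if on the target `U(H)(L ⊗ ℝ)` every `det`-compatible
system `(m′, m, m_H, t′, t, t_H)` w.r.t. `(Φ_* ν₂, ν, ν_H)` admits transfer of `C_c^∞` for the pushed factor `T₂^Φ = T₂.comap Φ⁻¹` (★ `IsArchDeltaTransferExists … (ArchSmooth L 3 H)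
(ArchSmooth₂ L)`), then so does every `det`-compatible system on the source `U(H₂)(L ⊗ ℝ)` w.r.t. `(ν₂, ν, ν_H)` for `T₂`: push the system by §1 (the `H_∞`-half does not move),
transfer `a₂ ∘ Φ⁻¹ ∈ C_c^∞(U(H))` (★ `ArchSmooth.comp_archCongr_symm`) to some `a^H`, which IS a `T₂`-transfer of `a₂` relative to `m₂` — «`f′_v → f′_v^H` is defined via
`f_v = f′_v ∘ ψ_v⁻¹`» (★ `isArchDeltaTransfer_comap_iff`, ★ `TransferFactorData.comap_symm_comap`).  Borel σ-algebras on all orbit quotients (pinned in the binders).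
[cite: Rogawski1990, §14.4 p. 237; §14.3 pp. 233–234; §4.3 (4.3.1) p. 43; §1.7 p. 6] [cite: PlatonovRapinchuk1994, §2.3] -/
theorem isArchDeltaTransferExists_of_archCongr_of_det (T₂ : ArchTransferFactor L H₂) (hdetH : H.det ≠ 0) (hdet₂ : H₂.det ≠ 0)
    (h : ∀ (m' : @OrbitalMeasureFamily (UnitaryGroup.arch (↥(maximalRealSubfield L)) L (IsCMField.complexConj L) 3 H) _ (fun _ => borel _)) (m : @OrbitalMeasureFamily (UnitaryGroup.arch (↥(maximalRealSubfield L)) L (IsCMField.complexConj L) 3 (Matrix.of fun i j : Fin 3 => if i.val + j.val + 1 = 3 then (1 : L) else 0)) _ (fun _ => borel _))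
        (mH : @OrbitalMeasureFamily (UnitaryGroup.arch (↥(maximalRealSubfield L)) L (IsCMField.complexConj L) 2 (Matrix.of fun i j : Fin 2 => if i.val + j.val + 1 = 2 then (1 : L) else 0) × UnitaryGroup.arch (↥(maximalRealSubfield L)) L (IsCMField.complexConj L) 1 (Matrix.of fun i j : Fin 1 => if i.val + j.val + 1 = 1 then (1 : L) else 0)) _ (fun _ => borel _))
        (t' : ∀ δ : UnitaryGroup.arch (↥(maximalRealSubfield L)) L (IsCMField.complexConj L) 3 H,
      Measure (Subgroup.centralizer ({δ} : Set (UnitaryGroup.arch (↥(maximalRealSubfield L)) L (IsCMField.complexConj L) 3 H))))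
        (t : ∀ γ : UnitaryGroup.arch (↥(maximalRealSubfield L)) L (IsCMField.complexConj L) 3 (Matrix.of fun i j : Fin 3 => if i.val + j.val + 1 = 3 then (1 : L) else 0),
      Measure (Subgroup.centralizer ({γ} : Set (UnitaryGroup.arch (↥(maximalRealSubfield L)) L (IsCMField.complexConj L) 3 (Matrix.of fun i j : Fin 3 => if i.val + j.val + 1 = 3 then (1 : L) else 0)))))
        (tH : ∀ γH : UnitaryGroup.arch (↥(maximalRealSubfield L)) L (IsCMField.complexConj L) 2 (Matrix.of fun i j : Fin 2 => if i.val + j.val + 1 = 2 then (1 : L) else 0) × UnitaryGroup.arch (↥(maximalRealSubfield L)) L (IsCMField.complexConj L) 1 (Matrix.of fun i j : Fin 1 => if i.val + j.val + 1 = 1 then (1 : L) else 0),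
      Measure (Subgroup.centralizer ({γH} : Set (UnitaryGroup.arch (↥(maximalRealSubfield L)) L (IsCMField.complexConj L) 2 (Matrix.of fun i j : Fin 2 => if i.val + j.val + 1 = 2 then (1 : L) else 0) × UnitaryGroup.arch (↥(maximalRealSubfield L)) L (IsCMField.complexConj L) 1 (Matrix.of fun i j : Fin 1 => if i.val + j.val + 1 = 1 then (1 : L) else 0))))),
      ArchCompatibleFamiliesGDet L H νt ν hdetH m' m t' t → ArchCompatibleFamiliesH L νH mH tH t →
        IsArchDeltaTransferExists L H (T₂.comap Φ.symm.toMulEquiv (fun γH b hb => (isArchNormPair_archCongr_symm_iff L T Φ hΦ γH b).1 hb)) mH m'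
          (ArchSmooth L 3 H) (ArchSmooth₂ L))
    {m₂ : @OrbitalMeasureFamily (UnitaryGroup.arch (↥(maximalRealSubfield L)) L (IsCMField.complexConj L) 3 H₂) _ (fun _ => borel _)} {m : @OrbitalMeasureFamily (UnitaryGroup.arch (↥(maximalRealSubfield L)) L (IsCMField.complexConj L) 3 (Matrix.of fun i j : Fin 3 => if i.val + j.val + 1 = 3 then (1 : L) else 0)) _ (fun _ => borel _)}
    {mH : @OrbitalMeasureFamily (UnitaryGroup.arch (↥(maximalRealSubfield L)) L (IsCMField.complexConj L) 2 (Matrix.of fun i j : Fin 2 => if i.val + j.val + 1 = 2 then (1 : L) else 0) × UnitaryGroup.arch (↥(maximalRealSubfield L)) L (IsCMField.complexConj L) 1 (Matrix.of fun i j : Fin 1 => if i.val + j.val + 1 = 1 then (1 : L) else 0)) _ (fun _ => borel _)}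
    {t₂ : ∀ δ : UnitaryGroup.arch (↥(maximalRealSubfield L)) L (IsCMField.complexConj L) 3 H₂,
      Measure (Subgroup.centralizer ({δ} : Set (UnitaryGroup.arch (↥(maximalRealSubfield L)) L (IsCMField.complexConj L) 3 H₂)))}
    {t : ∀ γ : UnitaryGroup.arch (↥(maximalRealSubfield L)) L (IsCMField.complexConj L) 3 (Matrix.of fun i j : Fin 3 => if i.val + j.val + 1 = 3 then (1 : L) else 0),
      Measure (Subgroup.centralizer ({γ} : Set (UnitaryGroup.arch (↥(maximalRealSubfield L)) L (IsCMField.complexConj L) 3 (Matrix.of fun i j : Fin 3 => if i.val + j.val + 1 = 3 then (1 : L) else 0))))}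
    {tH : ∀ γH : UnitaryGroup.arch (↥(maximalRealSubfield L)) L (IsCMField.complexConj L) 2 (Matrix.of fun i j : Fin 2 => if i.val + j.val + 1 = 2 then (1 : L) else 0) × UnitaryGroup.arch (↥(maximalRealSubfield L)) L (IsCMField.complexConj L) 1 (Matrix.of fun i j : Fin 1 => if i.val + j.val + 1 = 1 then (1 : L) else 0),
      Measure (Subgroup.centralizer ({γH} : Set (UnitaryGroup.arch (↥(maximalRealSubfield L)) L (IsCMField.complexConj L) 2 (Matrix.of fun i j : Fin 2 => if i.val + j.val + 1 = 2 then (1 : L) else 0) × UnitaryGroup.arch (↥(maximalRealSubfield L)) L (IsCMField.complexConj L) 1 (Matrix.of fun i j : Fin 1 => if i.val + j.val + 1 = 1 then (1 : L) else 0))))}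
    (hG : ArchCompatibleFamiliesGDet L H₂ ν₂ ν hdet₂ m₂ m t₂ t) (hH : ArchCompatibleFamiliesH L νH mH tH t) :
    IsArchDeltaTransferExists L H₂ T₂ mH m₂ (ArchSmooth L 3 H₂) (ArchSmooth₂ L) := by
  intro a₂ ha₂
  -- σ-algebras on the orbit quotients: Borel (as pinned in the binders), named for the transport lemmas
  letI iTm : ∀ δ : UnitaryGroup.arch (↥(maximalRealSubfield L)) L (IsCMField.complexConj L) 3 H, MeasurableSpace (UnitaryGroup.arch (↥(maximalRealSubfield L)) L (IsCMField.complexConj L) 3 H ⧸ Subgroup.centralizer ({δ} : Set (UnitaryGroup.arch (↥(maximalRealSubfield L)) L (IsCMField.complexConj L) 3 H))) := fun _ => borel _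
  haveI iTb : ∀ δ : UnitaryGroup.arch (↥(maximalRealSubfield L)) L (IsCMField.complexConj L) 3 H, BorelSpace (UnitaryGroup.arch (↥(maximalRealSubfield L)) L (IsCMField.complexConj L) 3 H ⧸ Subgroup.centralizer ({δ} : Set (UnitaryGroup.arch (↥(maximalRealSubfield L)) L (IsCMField.complexConj L) 3 H))) := fun _ => ⟨rfl⟩
  letI iSm : ∀ γ : UnitaryGroup.arch (↥(maximalRealSubfield L)) L (IsCMField.complexConj L) 3 H₂, MeasurableSpace (UnitaryGroup.arch (↥(maximalRealSubfield L)) L (IsCMField.complexConj L) 3 H₂ ⧸ Subgroup.centralizer ({γ} : Set (UnitaryGroup.arch (↥(maximalRealSubfield L)) L (IsCMField.complexConj L) 3 H₂))) := fun _ => borel _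
  haveI iSb : ∀ γ : UnitaryGroup.arch (↥(maximalRealSubfield L)) L (IsCMField.complexConj L) 3 H₂, BorelSpace (UnitaryGroup.arch (↥(maximalRealSubfield L)) L (IsCMField.complexConj L) 3 H₂ ⧸ Subgroup.centralizer ({γ} : Set (UnitaryGroup.arch (↥(maximalRealSubfield L)) L (IsCMField.complexConj L) 3 H₂))) := fun _ => ⟨rfl⟩
  letI iHm : ∀ a : (UnitaryGroup.arch (↥(maximalRealSubfield L)) L (IsCMField.complexConj L) 2 (Matrix.of fun i j : Fin 2 => if i.val + j.val + 1 = 2 then (1 : L) else 0) × UnitaryGroup.arch (↥(maximalRealSubfield L)) L (IsCMField.complexConj L) 1 (Matrix.of fun i j : Fin 1 => if i.val + j.val + 1 = 1 then (1 : L) else 0)), MeasurableSpace ((UnitaryGroup.arch (↥(maximalRealSubfield L)) L (IsCMField.complexConj L) 2 (Matrix.of fun i j : Fin 2 => if i.val + j.val + 1 = 2 then (1 : L) else 0) × UnitaryGroup.arch (↥(maximalRealSubfield L)) L (IsCMField.complexConj L) 1 (Matrix.of fun i j : Fin 1 => if i.val + j.val + 1 = 1 then (1 : L) else 0)) ⧸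 Subgroup.centralizer ({a} : Set (UnitaryGroup.arch (↥(maximalRealSubfield L)) L (IsCMField.complexConj L) 2 (Matrix.of fun i j : Fin 2 => if i.val + j.val + 1 = 2 then (1 : L) else 0) × UnitaryGroup.arch (↥(maximalRealSubfield L)) L (IsCMField.complexConj L) 1 (Matrix.of fun i j : Fin 1 => if i.val + j.val + 1 = 1 then (1 : L) else 0)))) := fun _ => borel _
  haveI iHb : ∀ a : (UnitaryGroup.arch (↥(maximalRealSubfield L)) L (IsCMField.complexConj L) 2 (Matrix.of fun i j : Fin 2 => if i.val + j.val + 1 = 2 then (1 : L) else 0) × UnitaryGroup.arch (↥(maximalRealSubfield L)) L (IsCMField.complexConj L) 1 (Matrix.of fun i j : Fin 1 => if i.val + j.val + 1 = 1 then (1 : L) else 0)), BorelSpace ((UnitaryGroup.arch (↥(maximalRealSubfield L)) L (IsCMField.complexConj L) 2 (Matrix.of fun i j : Fin 2 => if i.val + j.val + 1 = 2 then (1 : L) else 0) × UnitaryGroup.arch (↥(maximalRealSubfield L)) L (IsCMField.complexConj L) 1 (Matrix.of fun i j : Fin 1 => if i.val + j.val + 1 = 1 then (1 : L) else 0)) ⧸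 Subgroup.centralizer ({a} : Set (UnitaryGroup.arch (↥(maximalRealSubfield L)) L (IsCMField.complexConj L) 2 (Matrix.of fun i j : Fin 2 => if i.val + j.val + 1 = 2 then (1 : L) else 0) × UnitaryGroup.arch (↥(maximalRealSubfield L)) L (IsCMField.complexConj L) 1 (Matrix.of fun i j : Fin 1 => if i.val + j.val + 1 = 1 then (1 : L) else 0)))) := fun _ => ⟨rfl⟩
  -- §1: push the `G′∕G`-half of the system along `Φ`
  obtain ⟨tp, hG'⟩ := ArchCompatibleFamiliesGDet.transport_archCongr L T Φ hΦ ν₂ νt hνt ν hdetH hdet₂ hG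
  -- the factor round trip `(T₂^Φ) ∘ (id × Φ) = T₂`
  have hTT : (T₂.comap Φ.symm.toMulEquiv (fun γH b hb => (isArchNormPair_archCongr_symm_iff L T Φ hΦ γH b).1 hb)).comap Φ.toMulEquiv
      (isArchNormPair_of_archCongr L T Φ hΦ) = T₂ :=
    TransferFactorData.comap_symm_comap T₂ Φ.toMulEquiv _ _
  -- FRAME-RELATIVE EXISTENCE ON THE TARGET, at the pushed system and the function `a₂ ∘ Φ⁻¹`
  obtain ⟨aH, haH, hrel⟩ := h (m₂.transport Φ.toMulEquiv Φ.continuous Φ.symm.continuous) m mH tp t tH hG' hH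
    (a₂ ∘ Φ.symm) (ha₂.comp_archCongr_symm L T Φ hΦ)
  refine ⟨aH, haH, ?_⟩
  -- read (4.3.1) back on the source: «`f_v = f′_v ∘ ψ_v⁻¹`»
  have h5 := (isArchDeltaTransfer_comap_iff L T Φ hΦ
    (T₂.comap Φ.symm.toMulEquiv (fun γH b hb => (isArchNormPair_archCongr_symm_iff L T Φ hΦ γH b).1 hb)) mH m₂ aH a₂).2 hrel
  rw [hTT] at h5
  exact h5

end Transport

/-! ## §3 The explicit factor `Δ″_∞` along a rational congruence `P`: from `U(H′)` to `U(ᵗc̄P H′ P)`, closed in the congruent form -/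

section Congr

variable (L : Type) [Field L] [NumberField L] [IsCMField L] (H' : Matrix (Fin 3) (Fin 3) L) (P : GL (Fin 3) L)
  [MeasurableSpace (UnitaryGroup.arch (↥(maximalRealSubfield L)) L (IsCMField.complexConj L) 3 (Matrix.of fun i j : Fin 3 => if i.val + j.val + 1 = 3 then (1 : L) else 0))] [BorelSpace (UnitaryGroup.arch (↥(maximalRealSubfield L)) L (IsCMField.complexConj L) 3 (Matrix.of fun i j : Fin 3 => if i.val + j.val + 1 = 3 then (1 : L) else 0))]
  [MeasurableSpace (UnitaryGroup.arch (↥(maximalRealSubfield L)) L (IsCMField.complexConj L) 2 (Matrix.of fun i j : Fin 2 => if i.val + j.val + 1 = 2 then (1 : L) else 0) × UnitaryGroup.arch (↥(maximalRealSubfield L)) L (IsCMField.complexConj L) 1 (Matrix.of fun i j : Fin 1 => if i.val + j.val + 1 = 1 then (1 : L) else 0))] [BorelSpace (UnitaryGroup.arch (↥(maximalRealSubfield L)) L (IsCMField.complexConj L) 2 (Matrix.of fun i j : Fin 2 => if i.val + j.val + 1 = 2 then (1 : L) else 0) × UnitaryGroup.arch (↥(maximalRealSubfield L)) L (IsCMField.complexConj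 L) 1 (Matrix.of fun i j : Fin 1 => if i.val + j.val + 1 = 1 then (1 : L) else 0))]
  (ν : Measure (UnitaryGroup.arch (↥(maximalRealSubfield L)) L (IsCMField.complexConj L) 3 (Matrix.of fun i j : Fin 3 => if i.val + j.val + 1 = 3 then (1 : L) else 0))) [ν.IsHaarMeasure] [ν.IsMulRightInvariant]
  (νH : Measure (UnitaryGroup.arch (↥(maximalRealSubfield L)) L (IsCMField.complexConj L) 2 (Matrix.of fun i j : Fin 2 => if i.val + j.val + 1 = 2 then (1 : L) else 0) × UnitaryGroup.arch (↥(maximalRealSubfield L)) L (IsCMField.complexConj L) 1 (Matrix.of fun i j : Fin 1 => if i.val + j.val + 1 = 1 then (1 : L) else 0))) [νH.IsHaarMeasure] [νH.IsMulRightInvariant]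

/-- `TransferFactorData` is determined by its factor `Δ` (the other fields are propositions). [cite: Rogawski1990, §4.3 p. 43] -/
private theorem transferFactorData_eq_of_Δ_eq' {A B : Type*} [Group A] [Group B] {R : A → B → Prop} {T₁ T₂ : TransferFactorData A B R} (h : T₁.Δ = T₂.Δ) :
    T₁ = T₂ := by
  cases T₁; cases T₂; cases h; rfl

/-- **§3 (det-keyed) THE EXPLICIT FACTOR ALONG A RATIONAL CONGRUENCE.**  For `H′` with `det H′ ≠ 0`, `P ∈ GL₃(L)` and the congruent form `ᵗ(c̄P) H′ P` (★ `formCongr (cmConjRingHom L) P H′`):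
if on `U(H′)(L ⊗ ℝ)` — for every Borel structure, every Haar measure `ν′` and both invariances `hl′`, `hr′` of `Δ″^{H′}` — every `det`-compatible system w.r.t. `(ν′, ν, ν_H)` admits
`Δ″^{H′}`-transfer of `C_c^∞` (★ `IsArchDeltaTransferExists L H′ (archExplicitTransferFactor L H′ μ hl′ hr′) …`), then the same holds on `U(ᵗc̄P H′ P)(L ⊗ ℝ)` for `Δ″^{ᵗc̄P H′ P}`, for
every `det` witness, Borel structure, Haar measure `ν₂` and invariances `hl₂`, `hr₂` there.  PROOF: along the arch congruence `Ψ : U(ᵗc̄P H′ P) ≃ₜ* U(H′)`, `g ↦ (P ⊗ 1) g (P ⊗ 1)⁻¹`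
(★ `unitaryGroupOfFormCongrOfEq`, ★ `coe_archCongr_apply`) the pushed factor of `Δ″^{ᵗc̄PH′P}` IS `Δ″^{H′}` (★ `archExplicitDelta_archCongr` — print's «`Δ″_v = Δ_v ∘ ψ_v`»), whose
invariances follow from `hl₂`, `hr₂`; then §2 with the hypothesis at `(H′, Ψ_* ν₂)`.  The conclusion is CLOSED in the matrix `ᵗc̄P H′ P`, so it can be rewritten along a form
identity (e.g. ★ `formCongr_quasiSplitFrame_diagonal`: `ᵗQ̄ · diag(½, 1, −½) · Q = Φ₃`, landing on the quasi-split group literally, `det` witness ★ `isUnit_antidiagOne_det`).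
[cite: Rogawski1990, §14.4 p. 237; §14.3 pp. 233–234; §14.1 p. 232; §4.3 (4.3.1) p. 43; §1.7 p. 6] [cite: PlatonovRapinchuk1994, §2.3] -/
theorem isArchDeltaTransferExists_explicit_formCongr_of_det (hdet : H'.det ≠ 0) (μ : HeckeCharacter L)
    (hD : ∀ [MeasurableSpace (UnitaryGroup.arch (↥(maximalRealSubfield L)) L (IsCMField.complexConj L) 3 H')] [BorelSpace (UnitaryGroup.arch (↥(maximalRealSubfield L)) L (IsCMField.complexConj L) 3 H')]
      (ν' : Measure (UnitaryGroup.arch (↥(maximalRealSubfield L)) L (IsCMField.complexConj L) 3 H')) [ν'.IsHaarMeasure] [ν'.IsMulRightInvariant]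
      (hl' : ∀ (a : UnitaryGroup.arch (↥(maximalRealSubfield L)) L (IsCMField.complexConj L) 2 (Matrix.of fun i j : Fin 2 => if i.val + j.val + 1 = 2 then (1 : L) else 0) × UnitaryGroup.arch (↥(maximalRealSubfield L)) L (IsCMField.complexConj L) 1 (Matrix.of fun i j : Fin 1 => if i.val + j.val + 1 = 1 then (1 : L) else 0)) (b : UnitaryGroup.arch (↥(maximalRealSubfield L)) L (IsCMField.complexConj L) 3 H') (x : UnitaryGroup.arch (↥(maximalRealSubfield L)) L (IsCMField.complexConj L) 2 (Matrix.of fun i j : Fin 2 => if i.val + j.val + 1 = 2 then (1 : L) else 0) × UnitaryGroup.arch (↥(maximalRealSubfield L)) L (IsCMField.complexConj L) 1 (Matrix.of fun i j : Fin 1 => if i.val + j.val + 1 = 1 then (1 : L) else 0)),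
        archExplicitDelta L H' (x * a * x⁻¹) μ b = archExplicitDelta L H' a μ b)
      (hr' : ∀ (a : UnitaryGroup.arch (↥(maximalRealSubfield L)) L (IsCMField.complexConj L) 2 (Matrix.of fun i j : Fin 2 => if i.val + j.val + 1 = 2 then (1 : L) else 0) × UnitaryGroup.arch (↥(maximalRealSubfield L)) L (IsCMField.complexConj L) 1 (Matrix.of fun i j : Fin 1 => if i.val + j.val + 1 = 1 then (1 : L) else 0)) (b y : UnitaryGroup.arch (↥(maximalRealSubfield L)) L (IsCMField.complexConj L) 3 H'),
        archExplicitDelta L H' a μ (y * b * y⁻¹) = archExplicitDelta L H' a μ b)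
      (m' : @OrbitalMeasureFamily (UnitaryGroup.arch (↥(maximalRealSubfield L)) L (IsCMField.complexConj L) 3 H') _ (fun _ => borel _)) (m : @OrbitalMeasureFamily (UnitaryGroup.arch (↥(maximalRealSubfield L)) L (IsCMField.complexConj L) 3 (Matrix.of fun i j : Fin 3 => if i.val + j.val + 1 = 3 then (1 : L) else 0)) _ (fun _ => borel _))
      (mH : @OrbitalMeasureFamily (UnitaryGroup.arch (↥(maximalRealSubfield L)) L (IsCMField.complexConj L) 2 (Matrix.of fun i j : Fin 2 => if i.val + j.val + 1 = 2 then (1 : L) else 0) × UnitaryGroup.arch (↥(maximalRealSubfield L)) L (IsCMField.complexConj L) 1 (Matrix.of fun i j : Fin 1 => if i.val + j.val + 1 = 1 then (1 : L) else 0)) _ (fun _ => borel _))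
      (t' : ∀ δ : UnitaryGroup.arch (↥(maximalRealSubfield L)) L (IsCMField.complexConj L) 3 H',
      Measure (Subgroup.centralizer ({δ} : Set (UnitaryGroup.arch (↥(maximalRealSubfield L)) L (IsCMField.complexConj L) 3 H'))))
      (t : ∀ γ : UnitaryGroup.arch (↥(maximalRealSubfield L)) L (IsCMField.complexConj L) 3 (Matrix.of fun i j : Fin 3 => if i.val + j.val + 1 = 3 then (1 : L) else 0),
      Measure (Subgroup.centralizer ({γ} : Set (UnitaryGroup.arch (↥(maximalRealSubfield L)) L (IsCMField.complexConj L) 3 (Matrix.of fun i j : Fin 3 => if i.val + j.val + 1 = 3 then (1 : L) else 0)))))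
      (tH : ∀ γH : UnitaryGroup.arch (↥(maximalRealSubfield L)) L (IsCMField.complexConj L) 2 (Matrix.of fun i j : Fin 2 => if i.val + j.val + 1 = 2 then (1 : L) else 0) × UnitaryGroup.arch (↥(maximalRealSubfield L)) L (IsCMField.complexConj L) 1 (Matrix.of fun i j : Fin 1 => if i.val + j.val + 1 = 1 then (1 : L) else 0),
      Measure (Subgroup.centralizer ({γH} : Set (UnitaryGroup.arch (↥(maximalRealSubfield L)) L (IsCMField.complexConj L) 2 (Matrix.of fun i j : Fin 2 => if i.val + j.val + 1 = 2 then (1 : L) else 0) × UnitaryGroup.arch (↥(maximalRealSubfield L)) L (IsCMField.complexConj L) 1 (Matrix.of fun i j : Fin 1 => if i.val + j.val + 1 = 1 then (1 : L) else 0))))),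
      ArchCompatibleFamiliesGDet L H' ν' ν hdet m' m t' t → ArchCompatibleFamiliesH L νH mH tH t →
        IsArchDeltaTransferExists L H' (archExplicitTransferFactor L H' μ hl' hr') mH m' (ArchSmooth L 3 H') (ArchSmooth₂ L)) :
    ∀ (hdet₂ : (formCongr (cmConjRingHom L) P H').det ≠ 0) [MeasurableSpace (UnitaryGroup.arch (↥(maximalRealSubfield L)) L (IsCMField.complexConj L) 3 (formCongr (cmConjRingHom L) P H'))] [BorelSpace (UnitaryGroup.arch (↥(maximalRealSubfield L)) L (IsCMField.complexConj L) 3 (formCongr (cmConjRingHom L) P H'))]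
      (ν₂ : Measure (UnitaryGroup.arch (↥(maximalRealSubfield L)) L (IsCMField.complexConj L) 3 (formCongr (cmConjRingHom L) P H'))) [ν₂.IsHaarMeasure] [ν₂.IsMulRightInvariant]
      (hl₂ : ∀ (a : UnitaryGroup.arch (↥(maximalRealSubfield L)) L (IsCMField.complexConj L) 2 (Matrix.of fun i j : Fin 2 => if i.val + j.val + 1 = 2 then (1 : L) else 0) × UnitaryGroup.arch (↥(maximalRealSubfield L)) L (IsCMField.complexConj L) 1 (Matrix.of fun i j : Fin 1 => if i.val + j.val + 1 = 1 then (1 : L) else 0)) (b : UnitaryGroup.arch (↥(maximalRealSubfield L)) L (IsCMField.complexConj L) 3 (formCongr (cmConjRingHom L) P H')) (x : UnitaryGroup.arch (↥(maximalRealSubfield L)) L (IsCMField.complexConj L) 2 (Matrix.of fun i j : Fin 2 => if i.val + j.val + 1 = 2 then (1 : L) else 0) × UnitaryGroup.arch (↥(maximalRealSubfield L)) L (IsCMField.complexConj L) 1 (Matrix.of fun i j : Fin 1 => if i.val + j.val + 1 = 1 then (1 : L) else 0)),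
        archExplicitDelta L (formCongr (cmConjRingHom L) P H') (x * a * x⁻¹) μ b = archExplicitDelta L (formCongr (cmConjRingHom L) P H') a μ b)
      (hr₂ : ∀ (a : UnitaryGroup.arch (↥(maximalRealSubfield L)) L (IsCMField.complexConj L) 2 (Matrix.of fun i j : Fin 2 => if i.val + j.val + 1 = 2 then (1 : L) else 0) × UnitaryGroup.arch (↥(maximalRealSubfield L)) L (IsCMField.complexConj L) 1 (Matrix.of fun i j : Fin 1 => if i.val + j.val + 1 = 1 then (1 : L) else 0)) (b y : UnitaryGroup.arch (↥(maximalRealSubfield L)) L (IsCMField.complexConj L) 3 (formCongr (cmConjRingHom L) P H')),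
        archExplicitDelta L (formCongr (cmConjRingHom L) P H') a μ (y * b * y⁻¹) = archExplicitDelta L (formCongr (cmConjRingHom L) P H') a μ b)
      (m₂ : @OrbitalMeasureFamily (UnitaryGroup.arch (↥(maximalRealSubfield L)) L (IsCMField.complexConj L) 3 (formCongr (cmConjRingHom L) P H')) _ (fun _ => borel _)) (m : @OrbitalMeasureFamily (UnitaryGroup.arch (↥(maximalRealSubfield L)) L (IsCMField.complexConj L) 3 (Matrix.of fun i j : Fin 3 => if i.val + j.val + 1 = 3 then (1 : L) else 0)) _ (fun _ => borel _))
      (mH : @OrbitalMeasureFamily (UnitaryGroup.arch (↥(maximalRealSubfield L)) L (IsCMField.complexConj L) 2 (Matrix.of fun i j : Fin 2 => if i.val + j.val + 1 = 2 then (1 : L) else 0) × UnitaryGroup.arch (↥(maximalRealSubfield L)) L (IsCMField.complexConj L) 1 (Matrix.of fun i j : Fin 1 => if i.val + j.val + 1 = 1 then (1 : L) else 0)) _ (fun _ => borel _))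
      (t₂ : ∀ δ : UnitaryGroup.arch (↥(maximalRealSubfield L)) L (IsCMField.complexConj L) 3 (formCongr (cmConjRingHom L) P H'),
      Measure (Subgroup.centralizer ({δ} : Set (UnitaryGroup.arch (↥(maximalRealSubfield L)) L (IsCMField.complexConj L) 3 (formCongr (cmConjRingHom L) P H')))))
      (t : ∀ γ : UnitaryGroup.arch (↥(maximalRealSubfield L)) L (IsCMField.complexConj L) 3 (Matrix.of fun i j : Fin 3 => if i.val + j.val + 1 = 3 then (1 : L) else 0),
      Measure (Subgroup.centralizer ({γ} : Set (UnitaryGroup.arch (↥(maximalRealSubfield L)) L (IsCMField.complexConj L) 3 (Matrix.of fun i j : Fin 3 => if i.val + j.val + 1 = 3 then (1 : L) else 0)))))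
      (tH : ∀ γH : UnitaryGroup.arch (↥(maximalRealSubfield L)) L (IsCMField.complexConj L) 2 (Matrix.of fun i j : Fin 2 => if i.val + j.val + 1 = 2 then (1 : L) else 0) × UnitaryGroup.arch (↥(maximalRealSubfield L)) L (IsCMField.complexConj L) 1 (Matrix.of fun i j : Fin 1 => if i.val + j.val + 1 = 1 then (1 : L) else 0),
      Measure (Subgroup.centralizer ({γH} : Set (UnitaryGroup.arch (↥(maximalRealSubfield L)) L (IsCMField.complexConj L) 2 (Matrix.of fun i j : Fin 2 => if i.val + j.val + 1 = 2 then (1 : L) else 0) × UnitaryGroup.arch (↥(maximalRealSubfield L)) L (IsCMField.complexConj L) 1 (Matrix.of fun i j : Fin 1 => if i.val + j.val + 1 = 1 then (1 : L) else 0))))),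
      ArchCompatibleFamiliesGDet L (formCongr (cmConjRingHom L) P H') ν₂ ν hdet₂ m₂ m t₂ t → ArchCompatibleFamiliesH L νH mH tH t →
        IsArchDeltaTransferExists L (formCongr (cmConjRingHom L) P H') (archExplicitTransferFactor L (formCongr (cmConjRingHom L) P H') μ hl₂ hr₂) mH m₂
          (ArchSmooth L 3 (formCongr (cmConjRingHom L) P H')) (ArchSmooth₂ L) := by
  intro hdet₂ _ _ ν₂ _ _ hl₂ hr₂ m₂ m mH t₂ t tH hG hH
  -- the arch congruence `Ψ : U(ᵗc̄P H′ P)(L ⊗ ℝ) ≃ₜ* U(H′)(L ⊗ ℝ)` as the ABSTRACT FRAME `(T := P ⊗ 1, Φ := Ψ, hΨ)` of §2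
  let Ψ : UnitaryGroup.arch (↥(maximalRealSubfield L)) L (IsCMField.complexConj L) 3 (formCongr (cmConjRingHom L) P H') ≃ₜ* UnitaryGroup.arch (↥(maximalRealSubfield L)) L (IsCMField.complexConj L) 3 H' :=
    unitaryGroupOfFormCongrOfEq (UnitaryGroup.conjMixed (↥(maximalRealSubfield L)) L (IsCMField.complexConj L))
      (Matrix.GeneralLinearGroup.map (mixedEmbedding L) P) (UnitaryGroup.archFormOf L 3 H') _ (UnitaryGroup.archFormOf_formCongr L P H').symm
  have hΨ : ∀ g : UnitaryGroup.arch (↥(maximalRealSubfield L)) L (IsCMField.complexConj L) 3 (formCongr (cmConjRingHom L) P H'),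
      ((Ψ g : UnitaryGroup.arch (↥(maximalRealSubfield L)) L (IsCMField.complexConj L) 3 H') : GL (Fin 3) (mixedSpace L)) =
        Matrix.GeneralLinearGroup.map (mixedEmbedding L) P * (g : GL (Fin 3) (mixedSpace L)) * (Matrix.GeneralLinearGroup.map (mixedEmbedding L) P)⁻¹ :=
    fun g => UnitaryGroup.coe_archCongr_apply L P H' g
  -- σ-algebras and the pushed Haar measure on `U(H′)`
  letI : MeasurableSpace (UnitaryGroup.arch (↥(maximalRealSubfield L)) L (IsCMField.complexConj L) 3 H') := borel _
  haveI : BorelSpace (UnitaryGroup.arch (↥(maximalRealSubfield L)) L (IsCMField.complexConj L) 3 H') := ⟨rfl⟩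
  haveI h1 : (ν₂.map Ψ).IsHaarMeasure := ContinuousMulEquiv.isHaarMeasure_map ν₂ Ψ
  haveI h2 : (ν₂.map Ψ).IsMulRightInvariant := isMulRightInvariant_map_mulEquiv_of_isMulRightInvariant Ψ.toMulEquiv Ψ.continuous.measurable ν₂
  -- `Δ″` is a congruence invariant; the invariances of `Δ″^{H′}` from those of `Δ″^{ᵗc̄PH′P}`
  have hT : formCongr (UnitaryGroup.conjMixed (↥(maximalRealSubfield L)) L (IsCMField.complexConj L)) (Matrix.GeneralLinearGroup.map (mixedEmbedding L) P)
      (UnitaryGroup.archFormOf L 3 H') = UnitaryGroup.archFormOf L 3 (formCongr (cmConjRingHom L) P H') :=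
    (UnitaryGroup.archFormOf_formCongr L P H').symm
  have hΔ : ∀ (a : UnitaryGroup.arch (↥(maximalRealSubfield L)) L (IsCMField.complexConj L) 2 (Matrix.of fun i j : Fin 2 => if i.val + j.val + 1 = 2 then (1 : L) else 0) × UnitaryGroup.arch (↥(maximalRealSubfield L)) L (IsCMField.complexConj L) 1 (Matrix.of fun i j : Fin 1 => if i.val + j.val + 1 = 1 then (1 : L) else 0)) (g : UnitaryGroup.arch (↥(maximalRealSubfield L)) L (IsCMField.complexConj L) 3 H'),
      archExplicitDelta L H' a μ g = archExplicitDelta L (formCongr (cmConjRingHom L) P H') a μ (Ψ.symm g) := fun a g => by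
    rw [← archExplicitDelta_archCongr L (Matrix.GeneralLinearGroup.map (mixedEmbedding L) P) Ψ hΨ hT a μ (Ψ.symm g), ContinuousMulEquiv.apply_symm_apply]
  have hl' : ∀ (a : UnitaryGroup.arch (↥(maximalRealSubfield L)) L (IsCMField.complexConj L) 2 (Matrix.of fun i j : Fin 2 => if i.val + j.val + 1 = 2 then (1 : L) else 0) × UnitaryGroup.arch (↥(maximalRealSubfield L)) L (IsCMField.complexConj L) 1 (Matrix.of fun i j : Fin 1 => if i.val + j.val + 1 = 1 then (1 : L) else 0)) (b : UnitaryGroup.arch (↥(maximalRealSubfield L)) L (IsCMField.complexConj L) 3 H') (x : UnitaryGroup.arch (↥(maximalRealSubfield L)) L (IsCMField.complexConj L) 2 (Matrix.of fun i j : Fin 2 => if i.val + j.val + 1 = 2 then (1 : L) else 0) × UnitaryGroup.arch (↥(maximalRealSubfield L)) L (IsCMField.complexConj L) 1 (Matrix.of fun i j : Fin 1 => if i.val + j.val + 1 = 1 then (1 : L) else 0)),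
      archExplicitDelta L H' (x * a * x⁻¹) μ b = archExplicitDelta L H' a μ b := fun a b x => by
    rw [hΔ, hΔ]; exact hl₂ a (Ψ.symm b) x
  have hr' : ∀ (a : UnitaryGroup.arch (↥(maximalRealSubfield L)) L (IsCMField.complexConj L) 2 (Matrix.of fun i j : Fin 2 => if i.val + j.val + 1 = 2 then (1 : L) else 0) × UnitaryGroup.arch (↥(maximalRealSubfield L)) L (IsCMField.complexConj L) 1 (Matrix.of fun i j : Fin 1 => if i.val + j.val + 1 = 1 then (1 : L) else 0)) (b y : UnitaryGroup.arch (↥(maximalRealSubfield L)) L (IsCMField.complexConj L) 3 H'),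
      archExplicitDelta L H' a μ (y * b * y⁻¹) = archExplicitDelta L H' a μ b := fun a b y => by
    rw [hΔ, hΔ, map_mul, map_mul, map_inv]; exact hr₂ a (Ψ.symm b) (Ψ.symm y)
  -- the pushed factor of `Δ″^{ᵗc̄PH′P}` along `Ψ` IS `Δ″^{H′}`
  have hfac : (archExplicitTransferFactor L (formCongr (cmConjRingHom L) P H') μ hl₂ hr₂).comap Ψ.symm.toMulEquiv
      (fun γH b hb => (isArchNormPair_archCongr_symm_iff L _ Ψ hΨ γH b).1 hb) = archExplicitTransferFactor L H' μ hl' hr' := by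
    refine transferFactorData_eq_of_Δ_eq' (funext fun a => funext fun g => ?_)
    show archExplicitDelta L (formCongr (cmConjRingHom L) P H') a μ (Ψ.symm g) = archExplicitDelta L H' a μ g
    exact (hΔ a g).symm
  -- §2 along `Ψ`, with the hypothesis at `(H′, Ψ_* ν₂)`
  refine isArchDeltaTransferExists_of_archCongr_of_det L _ Ψ hΨ ν₂ (ν₂.map Ψ) rfl ν νH (archExplicitTransferFactor L (formCongr (cmConjRingHom L) P H') μ hl₂ hr₂) hdet hdet₂ ?_ hG hH
  rw [hfac]
  exact hD (ν₂.map Ψ) hl' hr'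

end Congr

end Literature.NumberTheory.Rogawski1990

end
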